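import Summits.KontsevichZagierPeriods.KontsevichZagierPeriods.Theorems.CobordismMoveSignedSheetLemmas
import Summits.KontsevichZagierPeriods.KontsevichZagierPeriods.Theses.MultivaluedCoV

/-!
# `SignedSheetTransfer` (stmt-KontsevichZagierPeriods-5567, route CobordismMove) — PROVED

Sorry-free proof of the route declaration
`Summit.KontsevichZagierPeriods.KontsevichZagierPeriods.Theses.CobordismMove.SignedSheetTransfer`
(theorem `signedSheetTransfer_proof`, concluding it BY NAME), obtained from the six registered
stubs of the strategist line `split` (`Cruxes/SignedSheetTransfer/Lines/split.lean`), proved in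
`Theorems/CobordismMoveSignedSheetLemmas.lean`, composed through the typed decomposition

  `SignedSheetTransfer ⇐ SignedSheetPushforward (X₁) ∧ SignedCountRegroup (X₂)`

(`signedSheetPushforward_of`, `signedCountRegroup_of`, assembled inside `signedSheetTransfer_proof`).

* X₁ `SignedSheetPushforward` — MULTI-SHEET PUSHFORWARD with integer weights and no multiplicity
  hypothesis: `[r] − Σ_k c_k • [Φ_k σ_k, g_k] ∈ KZ.relations`. Proof: shrink the sheets to the open
  `ℚ`-semialgebraic pieces `V_k = interior σ_k ∖ ⋃_j ∂σ_j` (the bad set is closed and null,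
  `volume_frontier_eq_zero_of_isSemialgebraic`), on which the within-derivative data `Φ'_k` IS the
  Fréchet derivative, so `|det Φ'_k|` is `ℚ`-semialgebraic (`stub_jacobianSemialgebraic`: partials by
  `IsSemialgebraicFunOn.fderiv_apply_single`, Leibniz by `IsSemialgebraicFunOn.matrix_det`); push each
  zero-extended sheet term forward by ONE instance of rule (2) (`stub_singleSheetPush`), drop the null
  images `Φ_k(σ_k ∖ V_k)` (`stub_imageNullRestrict`, Mathlib's
  `addHaar_image_eq_zero_of_differentiableOn_of_addHaar_eq_zero`), and collect with the landed
  `ZeroCombination.zeroCombination_holds`.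
* X₂ `SignedCountRegroup` — CONSTANT SIGNED COUNT REGROUPS: on the equaliser
  `E = {y ∈ r'.domain | Σ_k c_k 1_{ρ_k.domain}(y) = D}` (semialgebraic by graph elimination
  `KZ.isSemialgebraic_sep_eq`, co-null by hypothesis) the extended indicators and `−D • r'|E` form a
  zero combination.
* Corollary `sheetTransfer_proof`: `MultivaluedCoV.SheetTransfer` (stmt-KontsevichZagierPeriods-2877)
  is the case `ε ≡ 1`, `D = N` (co-null images ⇒ the count is a.e. `N`).

Only rules (1) and (2) of the KZ calculus and Tarski–Seidenberg are used; nothing about values of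
periods. References: M. Kontsevich, D. Zagier, *Periods* (2001) §1.2 rules (1)–(2); J. Bochnak,
M. Coste, M.-F. Roy, *Real Algebraic Geometry* (1998) §2.2, Prop. 2.2.7; S. Basu, R. Pollack,
M.-F. Roy, *Algorithms in Real Algebraic Geometry* (2006) Prop. 2.83, Prop. 3.22; Mathlib
`MeasureTheory.integrableOn_image_iff_integrableOn_abs_det_fderiv_smul`.

The typed decomposition with NAMED pieces (`def SignedSheetPushforward`, `def SignedCountRegroup`,
assembly `signedSheetTransfer_of_subs`) is the registered skeleton
`Cruxes/SignedSheetTransfer/Lines/split.lean`.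
-/

noncomputable section

open MeasureTheory Set
open Literature.NumberTheory.Transcendental
open Literature.ModelTheory.ExponentialFields (IsSemialgebraic isSemialgebraic_interior
  isSemialgebraic_closure)

namespace Summit.KontsevichZagierPeriods.CobordismMove.SignedSheetTransferSplit

open Summit.KontsevichZagierPeriods.KontsevichZagierPeriods.Theses.CobordismMove
open Summit.KontsevichZagierPeriods.CobordismMove

variable {n : ℕ}

/-! ## Piece X₂ from its stubs (PROVED) -/

/-- Piece X₂ `SignedCountRegroup` (constant signed count regroups) from its two stubs: on the
equaliser `E = {y ∈ r'.domain | Σ_k c_k 1_{ρ_k.domain}(y) = D}` (semialgebraic by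
`KZ.isSemialgebraic_sep_eq`, co-null by hypothesis) the zero-extended representations and `−D • r'|E`
form a zero combination (`ZeroCombination.zeroCombination_holds`). -/
theorem signedCountRegroup_of
    (H₁ : ∀ {n N : ℕ} (τ : Set (Fin n → ℝ)) (T : Fin N → Set (Fin n → ℝ)) (c : Fin N → ℤ),
      IsSemialgebraic ℚ τ → (∀ k, IsSemialgebraic ℚ (T k)) →
      IsSemialgebraicFunOn ℚ τ (fun y => ∑ k : Fin N, (c k : ℝ) * (T k).indicator (fun _ => (1 : ℝ)) y))
    (H₂ : ∀ {n : ℕ} (R S : KZ.IntegralRep n) (T : Set (Fin n → ℝ)), IsSemialgebraic ℚ T →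
      S.domain = T ∩ R.domain → EqOn S.integrand R.integrand S.domain →
      ∃ W : KZ.IntegralRep n, W.domain = R.domain ∧ W.integrand = T.indicator R.integrand ∧
        KZ.of W - KZ.of S ∈ KZ.relations) :
    ∀ (n N : ℕ) (D : ℤ) (r' : Literature.NumberTheory.Transcendental.KZ.IntegralRep n) (c : Fin N → ℤ) (ρ : Fin N → Literature.NumberTheory.Transcendental.KZ.IntegralRep n), (∀ k, (ρ k).domain ⊆ r'.domain) → (∀ k, Set.EqOn (ρ k).integrand r'.integrand (ρ k).domain) → (∀ᵐ y ∂(MeasureTheory.volume.restrict r'.domain), (∑ k : Fin N, (c k : ℝ) * ((ρ k).domain).indicator (fun _ => (1 : ℝ)) y) = (D : ℝ)) → (∑ k : Fin N, c k • Literature.NumberTheory.Transcendental.KZ.of (ρ k)) - D • Literature.NumberTheory.Transcendental.KZ.of r' ∈ Literature.NumberTheory.Transcendental.KZ.relations := by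
  intro n N D r' c ρ hsub hint hcount
  classical
  -- notation
  set τ : Set (Fin n → ℝ) := r'.domain with hτ
  set T : Fin N → Set (Fin n → ℝ) := fun k => (ρ k).domain with hT
  set F : (Fin n → ℝ) → ℝ := fun y => ∑ k : Fin N, (c k : ℝ) * (T k).indicator (fun _ => (1 : ℝ)) y
    with hF
  have hτsa : IsSemialgebraic ℚ τ := r'.isSemialgebraic_domain
  have hTsa : ∀ k, IsSemialgebraic ℚ (T k) := fun k => (ρ k).isSemialgebraic_domain
  have hFsa : IsSemialgebraicFunOn ℚ τ F := H₁ τ T c hτsa hTsa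
  -- the good set `E = {y ∈ τ | F y = D}`
  set E : Set (Fin n → ℝ) := {y | y ∈ τ ∧ F y = (D : ℝ)} with hE
  have hEsa : IsSemialgebraic ℚ E :=
    isSemialgebraic_sep_eq hFsa (isSemialgebraicFunOn_ratCast hτsa (D : ℚ) |>.congr fun _ _ => by simp)
  have hEτ : E ⊆ τ := fun y hy => hy.1
  have hτm : MeasurableSet τ :=
    Literature.ModelTheory.ExponentialFields.IsSemialgebraic.measurableSet_holds hτsa
  have hnull : volume (τ \ E) = 0 := by
    have h1 : ∀ᵐ y ∂volume, y ∈ τ → F y = (D : ℝ) := (ae_restrict_iff' hτm).1 hcount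
    rw [ae_iff] at h1
    refine measure_mono_null (fun y hy => ?_) h1
    simp only [mem_setOf_eq, Classical.not_imp]
    exact ⟨hy.1, fun h => hy.2 ⟨hy.1, h⟩⟩
  -- restrictions to the good set
  set r'E : KZ.IntegralRep n := r'.restrict E hEsa hEτ with hr'E
  have e₀ : KZ.of r' - KZ.of r'E ∈ KZ.relations := r'.of_sub_of_restrict_mem_relations hEsa hEτ hnull
  have hTEsa : ∀ k, IsSemialgebraic ℚ (T k ∩ E) := fun k => (hTsa k).inter hEsa
  set ρE : Fin N → KZ.IntegralRep n := fun k =>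
    (ρ k).restrict (T k ∩ E) (hTEsa k) inter_subset_left with hρE
  have e₁ : ∀ k, KZ.of (ρ k) - KZ.of (ρE k) ∈ KZ.relations := fun k => by
    refine (ρ k).of_sub_of_restrict_mem_relations (hTEsa k) inter_subset_left ?_
    refine measure_mono_null (fun y hy => ?_) hnull
    exact ⟨hsub k hy.1, fun hyE => hy.2 ⟨hy.1, hyE⟩⟩
  -- the indicator extensions `W k = [E, 1_{T k} r'.integrand]`
  have hW : ∀ k, ∃ W : KZ.IntegralRep n, W.domain = E ∧
      W.integrand = (T k).indicator r'.integrand ∧ KZ.of W - KZ.of (ρE k) ∈ KZ.relations := by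
    intro k
    obtain ⟨W, hWd, hWi, hWr⟩ := H₂ r'E (ρE k) (T k) (hTsa k) rfl
      (fun y hy => hint k (show y ∈ (ρ k).domain from hy.1))
    exact ⟨W, hWd, hWi, hWr⟩
  choose W hWd hWi hWr using hW
  -- zero combination on the common domain `E`
  have hz := ZeroCombination.zeroCombination_holds n (N + 1) E (Fin.cons r'E W) (Fin.cons (-D) c)
    (fun i => Fin.cases rfl (fun k => hWd k) i) (fun y hy => by
      rw [Fin.sum_univ_succ]
      simp only [Fin.cons_zero, Fin.cons_succ, Int.cast_neg]
      have hy' : F y = D := hy.2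
      have hWy : ∀ k, (W k).integrand y = (T k).indicator (fun _ => (1 : ℝ)) y * r'.integrand y := by
        intro k
        rw [hWi k]
        by_cases hyk : y ∈ T k <;> simp [hyk]
      simp only [hWy, ← mul_assoc, ← Finset.sum_mul]
      have : (∑ k : Fin N, (c k : ℝ) * (T k).indicator (fun _ => (1 : ℝ)) y) = D := hy'
      rw [this]
      show -(D : ℝ) * r'.integrand y + (D : ℝ) * r'.integrand y = 0
      ring)
  rw [Fin.sum_univ_succ] at hz
  simp only [Fin.cons_zero, Fin.cons_succ] at hz
  -- collect
  have e₁' : ∑ k : Fin N, c k • (KZ.of (ρ k) - KZ.of (ρE k)) ∈ KZ.relations :=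
    KZ.relations.sum_mem fun k _ => KZ.relations.zsmul_mem (e₁ k) _
  have e₂' : ∑ k : Fin N, c k • (KZ.of (W k) - KZ.of (ρE k)) ∈ KZ.relations :=
    KZ.relations.sum_mem fun k _ => KZ.relations.zsmul_mem (hWr k) _
  have e₀' : D • (KZ.of r' - KZ.of r'E) ∈ KZ.relations := KZ.relations.zsmul_mem e₀ _
  have key : (∑ k : Fin N, c k • KZ.of (ρ k)) - D • KZ.of r' =
      ∑ k : Fin N, c k • (KZ.of (ρ k) - KZ.of (ρE k)) -
        ∑ k : Fin N, c k • (KZ.of (W k) - KZ.of (ρE k)) +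
        (-D • KZ.of r'E + ∑ k : Fin N, c k • KZ.of (W k)) - D • (KZ.of r' - KZ.of r'E) := by
    simp only [smul_sub, Finset.sum_sub_distrib, neg_smul]
    abel
  rw [key]
  exact KZ.relations.sub_mem (KZ.relations.add_mem (KZ.relations.sub_mem e₁' e₂') hz) e₀'


/-! ## Piece X₁ from its stubs (PROVED) -/

/-- Piece X₁ `SignedSheetPushforward` (multi-sheet signed pushforward, no multiplicity hypothesis)
from its four stubs: shrink the sheets to the open pieces `V_k` (`stub_sheetShrink`), where the
within-derivative data is the Fréchet derivative and the Jacobian factor is semialgebraic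
(`stub_jacobianSemialgebraic`); push every zero-extended sheet term forward separately
(`stub_singleSheetPush`), replace `[Φ_k V_k]` by `[Φ_k σ_k]` (`stub_imageNullRestrict`), and collect
the extended terms against `r|⋃V_k` by `ZeroCombination.zeroCombination_holds`. -/
theorem signedSheetPushforward_of
    (H₁ : ∀ {n : ℕ} (U : Set (Fin n → ℝ)) (Φ : (Fin n → ℝ) → (Fin n → ℝ)), IsOpen U →
      IsSemialgebraicMapOn ℚ U Φ → (∀ x ∈ U, DifferentiableAt ℝ Φ x) →
      IsSemialgebraicFunOn ℚ U (fun x => |(fderiv ℝ Φ x).det|))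
    (H₂ : ∀ {n N : ℕ} (σ : Fin N → Set (Fin n → ℝ)), (∀ k, IsSemialgebraic ℚ (σ k)) →
      ∃ V : Fin N → Set (Fin n → ℝ), (∀ k, IsOpen (V k)) ∧ (∀ k, IsSemialgebraic ℚ (V k)) ∧
        (∀ k, V k ⊆ σ k) ∧ volume (⋃ k, (σ k \ V k)) = 0 ∧
        (∀ x ∈ ⋃ k, V k, ∀ j, x ∈ σ j → x ∈ V j))
    (H₃ : ∀ {n : ℕ} (G V : Set (Fin n → ℝ)) (Φ : (Fin n → ℝ) → (Fin n → ℝ))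
      (Φ' : (Fin n → ℝ) → ((Fin n → ℝ) →L[ℝ] (Fin n → ℝ))) (ρ : KZ.IntegralRep n),
      IsSemialgebraic ℚ G → IsSemialgebraic ℚ V → V ⊆ G → IsSemialgebraicMapOn ℚ V Φ →
      (∀ x ∈ V, HasFDerivWithinAt Φ (Φ' x) V x) → InjOn Φ V → Φ '' V ⊆ ρ.domain →
      IsSemialgebraicFunOn ℚ V (fun x => ρ.integrand (Φ x) * |(Φ' x).det|) →
      ∃ R S : KZ.IntegralRep n, R.domain = G ∧
        R.integrand = V.indicator (fun x => ρ.integrand (Φ x) * |(Φ' x).det|) ∧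
        S.domain = Φ '' V ∧ S.integrand = ρ.integrand ∧ KZ.of R - KZ.of S ∈ KZ.relations)
    (H₄ : ∀ {n : ℕ} (σ V : Set (Fin n → ℝ)) (Φ : (Fin n → ℝ) → (Fin n → ℝ))
      (Φ' : (Fin n → ℝ) → ((Fin n → ℝ) →L[ℝ] (Fin n → ℝ))) (ρ S : KZ.IntegralRep n),
      V ⊆ σ → volume (σ \ V) = 0 → (∀ x ∈ σ, HasFDerivWithinAt Φ (Φ' x) σ x) →
      ρ.domain = Φ '' σ → S.domain = Φ '' V → EqOn S.integrand ρ.integrand S.domain →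
      KZ.of ρ - KZ.of S ∈ KZ.relations) :
    ∀ (n N : ℕ) (r : Literature.NumberTheory.Transcendental.KZ.IntegralRep n) (c : Fin N → ℤ) (σ : Fin N → Set (Fin n → ℝ)) (Φ : Fin N → (Fin n → ℝ) → (Fin n → ℝ)) (Φ' : Fin N → (Fin n → ℝ) → ((Fin n → ℝ) →L[ℝ] (Fin n → ℝ))) (ρ : Fin N → Literature.NumberTheory.Transcendental.KZ.IntegralRep n), (∀ k, Literature.ModelTheory.ExponentialFields.IsSemialgebraic ℚ (σ k)) → (∀ k, σ k ⊆ r.domain) → MeasureTheory.volume (r.domain \ ⋃ k, σ k) = 0 → (∀ k, Literature.NumberTheory.Transcendental.IsSemialgebraicMapOn ℚ (σ k) (Φ k)) → (∀ k, ∀ x ∈ σ k, HasFDerivWithinAt (Φ k) (Φ' k x) (σ k) x) → (∀ k, Set.InjOn (Φ k) (σ k)) → (∀ k, (ρ k).domain = Φ k '' σ k) → (∀ x ∈ ⋃ k, σ k, r.integrand x = ∑ k : Fin N, (c k : ℝ) * (σ k).indicator (fun y => (ρ k).integrand (Φ k y) * |(Φ' k y).det|) x) → Literature.NumberTheory.Transcendental.KZ.of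 r - ∑ k : Fin N, c k • Literature.NumberTheory.Transcendental.KZ.of (ρ k) ∈ Literature.NumberTheory.Transcendental.KZ.relations := by
  intro n N r c σ Φ Φ' ρ hσ hsub hnull hmap hder hinj hρ hintg
  classical
  -- shrink the sheets
  obtain ⟨V, hVo, hVsa, hVσ, hVnull, hVmem⟩ := H₂ σ hσ
  have hGsa : IsSemialgebraic ℚ (⋃ k, V k) := isSemialgebraic_iUnion hVsa
  have hGσ : (⋃ k, V k) ⊆ ⋃ k, σ k := iUnion_mono hVσ
  have hGr : (⋃ k, V k) ⊆ r.domain := hGσ.trans (iUnion_subset hsub)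
  -- derivative facts on the open pieces
  have hnhds : ∀ k, ∀ x ∈ V k, σ k ∈ nhds x := fun k x hx =>
    Filter.mem_of_superset ((hVo k).mem_nhds hx) (hVσ k)
  have hderAt : ∀ k, ∀ x ∈ V k, HasFDerivAt (Φ k) (Φ' k x) x := fun k x hx =>
    (hder k x (hVσ k hx)).hasFDerivAt (hnhds k x hx)
  have hfd : ∀ k, ∀ x ∈ V k, fderiv ℝ (Φ k) x = Φ' k x := fun k x hx => (hderAt k x hx).fderiv
  -- the sheet term is semialgebraic on `V k`
  have hmapV : ∀ k, IsSemialgebraicMapOn ℚ (V k) (Φ k) := fun k => (hmap k).mono (hVσ k) (hVsa k)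
  have hhsa : ∀ k, IsSemialgebraicFunOn ℚ (V k)
      (fun y => (ρ k).integrand (Φ k y) * |(Φ' k y).det|) := by
    intro k
    have hcomp : IsSemialgebraicFunOn ℚ (V k) ((ρ k).integrand ∘ Φ k) :=
      IsSemialgebraicFunOn.comp_isSemialgebraicMapOn_holds (ρ k).isSemialgebraicFunOn_integrand
        (hmapV k) (fun x hx => by rw [hρ k]; exact mem_image_of_mem _ (hVσ k hx))
    have hjac : IsSemialgebraicFunOn ℚ (V k) (fun x => |(fderiv ℝ (Φ k) x).det|) :=
      H₁ (V k) (Φ k) (hVo k) (hmapV k) (fun x hx => (hderAt k x hx).differentiableAt)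
    refine (IsSemialgebraicFunOn.mul_holds hcomp hjac).congr fun x hx => ?_
    simp [hfd k x hx]
  -- per-sheet pushforward (one change of variables each)
  have hRS : ∀ k, ∃ R S : KZ.IntegralRep n, R.domain = (⋃ k, V k) ∧
      R.integrand = (V k).indicator (fun y => (ρ k).integrand (Φ k y) * |(Φ' k y).det|) ∧
      S.domain = Φ k '' V k ∧ S.integrand = (ρ k).integrand ∧ KZ.of R - KZ.of S ∈ KZ.relations :=
    fun k => H₃ (⋃ k, V k) (V k) (Φ k) (Φ' k) (ρ k) hGsa (hVsa k) (subset_iUnion V k) (hmapV k)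
      (fun x hx => (hder k x (hVσ k hx)).mono (hVσ k)) ((hinj k).mono (hVσ k))
      (by rw [hρ k]; exact image_mono (hVσ k)) (hhsa k)
  choose R S hRd hRi hSd hSi hRS' using hRS
  -- the null part of each target sheet
  have e₂ : ∀ k, KZ.of (ρ k) - KZ.of (S k) ∈ KZ.relations := fun k =>
    H₄ (σ k) (V k) (Φ k) (Φ' k) (ρ k) (S k) (hVσ k)
      (measure_mono_null (subset_iUnion (fun k => σ k \ V k) k) hVnull) (hder k) (hρ k) (hSd k)
      (fun y _ => by rw [hSi k])
  -- restrict `r` to the open co-null set `⋃ V k`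
  have e₀ : KZ.of r - KZ.of (r.restrict (⋃ k, V k) hGsa hGr) ∈ KZ.relations := by
    refine r.of_sub_of_restrict_mem_relations hGsa hGr (measure_mono_null (fun x hx => ?_)
      (measure_union_null hnull hVnull))
    by_cases hxσ : x ∈ ⋃ k, σ k
    · obtain ⟨k, hk⟩ := mem_iUnion.1 hxσ
      exact Or.inr (mem_iUnion.2 ⟨k, hk, fun hxV => hx.2 (mem_iUnion.2 ⟨k, hxV⟩)⟩)
    · exact Or.inl ⟨hx.1, hxσ⟩
  -- zero combination on the common domain `⋃ V k`
  have hz := ZeroCombination.zeroCombination_holds n (N + 1) (⋃ k, V k)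
    (Fin.cons (r.restrict (⋃ k, V k) hGsa hGr) R) (Fin.cons (-1) c)
    (fun i => Fin.cases rfl (fun k => hRd k) i) (fun x hx => by
      rw [Fin.sum_univ_succ]
      simp only [Fin.cons_zero, Fin.cons_succ, Int.cast_neg, Int.cast_one,
        KZ.IntegralRep.integrand_restrict]
      have h2 : ∀ k, (σ k).indicator (fun y => (ρ k).integrand (Φ k y) * |(Φ' k y).det|) x =
          (R k).integrand x := by
        intro k
        rw [hRi k]
        by_cases hxk : x ∈ σ k
        · rw [indicator_of_mem hxk, indicator_of_mem (hVmem x hx k hxk)]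
        · rw [indicator_of_notMem hxk, indicator_of_notMem (fun h' => hxk (hVσ k h'))]
      rw [hintg x (hGσ hx)]
      simp only [h2]
      ring)
  rw [Fin.sum_univ_succ] at hz
  simp only [Fin.cons_zero, Fin.cons_succ, neg_smul, one_smul] at hz
  -- collect
  have e₁' : ∑ k : Fin N, c k • (KZ.of (R k) - KZ.of (S k)) ∈ KZ.relations :=
    KZ.relations.sum_mem fun k _ => KZ.relations.zsmul_mem (hRS' k) _
  have e₂' : ∑ k : Fin N, c k • (KZ.of (ρ k) - KZ.of (S k)) ∈ KZ.relations :=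
    KZ.relations.sum_mem fun k _ => KZ.relations.zsmul_mem (e₂ k) _
  have key : KZ.of r - ∑ k : Fin N, c k • KZ.of (ρ k) =
      (KZ.of r - KZ.of (r.restrict (⋃ k, V k) hGsa hGr)) -
        (-KZ.of (r.restrict (⋃ k, V k) hGsa hGr) + ∑ k : Fin N, c k • KZ.of (R k)) +
        ∑ k : Fin N, c k • (KZ.of (R k) - KZ.of (S k)) -
        ∑ k : Fin N, c k • (KZ.of (ρ k) - KZ.of (S k)) := by
    simp only [smul_sub, Finset.sum_sub_distrib]
    abel
  rw [key]
  exact KZ.relations.sub_mem (KZ.relations.add_mem (KZ.relations.sub_mem e₀ hz) e₁') e₂'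

/-! ## The crux (PROVED): assembly of the two pieces -/

/-- **`SignedSheetTransfer` holds** (the route declaration, BY NAME; no `sorry`). Assembly of the two
pieces: with the image representations `ρ_k = r' | Φ_k σ_k` (images `ℚ`-semialgebraic by
Tarski–Seidenberg), X₁ (`signedSheetPushforward_of …`) gives `[r] − Σ ε_k•[ρ_k] ∈ relations` and X₂
(`signedCountRegroup_of …`) gives `Σ ε_k•[ρ_k] − D•[r'] ∈ relations`; add. -/
theorem signedSheetTransfer_proof :
    Summit.KontsevichZagierPeriods.KontsevichZagierPeriods.Theses.CobordismMove.SignedSheetTransfer := by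
  intro n N D r r' ε σ Φ Φ' hε hσ hsub hnull hmap hder hinj himg hcount hintg
  have himgsa : ∀ k, IsSemialgebraic ℚ (Φ k '' σ k) := fun k =>
    IsSemialgebraicMapOn.isSemialgebraic_image_holds (hmap k) Subset.rfl (hσ k)
  set ρ : Fin N → KZ.IntegralRep n := fun k => r'.restrict (Φ k '' σ k) (himgsa k) (himg k) with hρ
  have e₁ : KZ.of r - ∑ k : Fin N, ε k • KZ.of (ρ k) ∈ KZ.relations :=
    signedSheetPushforward_of stub_jacobianSemialgebraic stub_sheetShrink stub_singleSheetPush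
      stub_imageNullRestrict n N r ε σ Φ Φ' ρ hσ hsub hnull hmap hder hinj (fun k => rfl) hintg
  have e₂ : (∑ k : Fin N, ε k • KZ.of (ρ k)) - D • KZ.of r' ∈ KZ.relations :=
    signedCountRegroup_of stub_countSemialgebraic stub_indicatorExtension n N D r' ε ρ
      (fun k => himg k) (fun k => fun x _ => rfl) hcount
  have := KZ.relations.add_mem e₁ e₂
  simpa using this

/-! ## Corollary: `MultivaluedCoV.SheetTransfer` (stmt-KontsevichZagierPeriods-2877)

The unsigned sheet-transfer crux of route `MultivaluedCoV` is the special case `ε ≡ 1`, `D = N`: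
when every image `Φ_k σ_k` is co-null in `r'.domain`, the count `Σ_k 1_{Φ_k σ_k}` is a.e. the
constant `N` on `r'.domain`. -/

/-- `SignedSheetTransfer → MultivaluedCoV.SheetTransfer` (`ε ≡ 1`, `D = N`). -/
theorem sheetTransfer_of_signedSheetTransfer
    (h : Summit.KontsevichZagierPeriods.KontsevichZagierPeriods.Theses.CobordismMove.SignedSheetTransfer) :
    Summit.KontsevichZagierPeriods.KontsevichZagierPeriods.Theses.MultivaluedCoV.SheetTransfer := by
  intro n N r r' σ Φ Φ' hσ hsub hnull hmap hder hinj himg hconull hintg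
  have hτm : MeasurableSet r'.domain :=
    Literature.ModelTheory.ExponentialFields.IsSemialgebraic.measurableSet_holds
      r'.isSemialgebraic_domain
  -- the count `Σ_k 1_{Φ_k σ_k}` is a.e. `N` on `r'.domain`
  have hcount : ∀ᵐ y ∂(volume.restrict r'.domain),
      (∑ k : Fin N, ((1 : ℤ) : ℝ) * (Φ k '' σ k).indicator (fun _ => (1 : ℝ)) y) = ((N : ℤ) : ℝ) := by
    have hall : ∀ k, ∀ᵐ y ∂(volume.restrict r'.domain), y ∈ Φ k '' σ k := by
      intro k
      rw [ae_restrict_iff' hτm]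
      have h0 : volume {y | ¬ (y ∈ r'.domain → y ∈ Φ k '' σ k)} = 0 :=
        measure_mono_null (fun y hy => by
          simp only [mem_setOf_eq, Classical.not_imp] at hy
          exact ⟨hy.1, hy.2⟩) (hconull k)
      exact h0
    have hall' : ∀ᵐ y ∂(volume.restrict r'.domain), ∀ k, y ∈ Φ k '' σ k := ae_all_iff.2 hall
    filter_upwards [hall'] with y hy
    simp [indicator_of_mem (hy _)]
  have key := h n N (N : ℤ) r r' (fun _ => 1) σ Φ Φ' (fun _ => Or.inl rfl) hσ hsub hnull hmap hder
    hinj himg hcount (fun x hx => by simpa using hintg x hx)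
  simpa [natCast_zsmul] using key

/-- **`MultivaluedCoV.SheetTransfer` holds** (stmt-KontsevichZagierPeriods-2877; sorry-free). -/
theorem sheetTransfer_proof :
    Summit.KontsevichZagierPeriods.KontsevichZagierPeriods.Theses.MultivaluedCoV.SheetTransfer :=
  sheetTransfer_of_signedSheetTransfer signedSheetTransfer_proof

end Summit.KontsevichZagierPeriods.CobordismMove.SignedSheetTransferSplit
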